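import Summits.BirchSwinnertonDyer.BirchSwinnertonDyer.Theorems.ThetaPartnerAtTwoSignedControlAtTwoMuRealShaDualCanonical
import HarnessLib

/-!
# Poitou–Tate at fields WITH REAL PLACES: the COUNT `#Ш²(K, M) ≤ #Ш¹(K, M^D)` from a readout of `Ш²` that is additive
# and injective modulo sums of local pairings — archimedean components live (Milne I Thm. 4.10 (a), counting half)

Crux K4 `SignedControlAtTwo` (stmt-BirchSwinnertonDyer-20309; routes `ThetaPartnerAtTwo` / `ResidualThetaTransportAtTwo`), line
`eulerchar` v12, lead `bsd-wall-tp2-p3` g4 (`--supports stmt-BirchSwinnertonDyer-20309`, helper).  Third file of the real-place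
consumer side of the registered stub `stub_poitouTateShaRat : poitouTate_sha_tateDual ℚ` (after `…MuRealShaDualAnnihilator`,
`…MuRealShaDualCanonical`).  What K4 actually CONSUMES of Milne I 4.10 (a) is the count `#Ш²(ℚ, E[2^k]) ≤ #Ш¹(ℚ, E[2^k]^D)`
with `Ш²` finite (width seat w2's `SignedEC.ShaTwo.finite_shaTwo_primary_and_natCard_le`); the count needs only the
ADDITIVE and INJECTIVE properties of the degree-2 readout `e : Ш²(K, M) → Hom(H¹(K, M^D), ℤ/n)` modulo local sums, not its
surjectivity.  The tree's count (`PoitouTateShaAnnihilator.natCard_shaTwo_le_of_readout`, seat bsd-line-chl-p2 g5) is for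
TOTALLY COMPLEX `K`; here it is proved for ANY number field, for a family of invariant maps injective at the real places
(the local sums then carry archimedean components, so the (inj) hypothesis quantifies over families unrestricted at `∞`).

* `natCard_shaTwo_le_of_readout_real` — any family with `IsPerfect`, `InjectiveAtRealPlaces`, `UnramifiedOrthogonal`,
  `SelmerComplement`; `Ш¹(K, M^D)` finite; readout additive + injective modulo local sums ⟹ `Ш²(K, M)` finite and
  `#Ш²(K, M) ≤ #Ш¹(K, M^D)`;
* **`natCard_shaTwo_le_canonical_of_middleExact_of_readout`** — THE invariant maps `LocalInvariants.canonical K n`: Milne I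
  4.10 (b) at level `n` (`hE(n)`, road (A)) + an additive, injective readout ⟹ `Ш¹(K, M^D)`, `Ш²(K, M)` finite and
  `#Ш²(K, M) ≤ #Ш¹(K, M^D)` — `Ш¹` finiteness DISCHARGED (`finite_sha_tateDual_of_isUnramifiedAt`).

HONEST FRAMING. THEOREMS ONLY (no definition, no named fact, no `sorry`); `hE(n)` and the readout are displayed hypotheses, NOT
discharged here; closes no item; BSD is not proved by any of this.  References: [MilneADT2006] I Thm. 4.10 (a)(b) and proof,
§0 Prop. 0.19, Thm. 2.13 (a), Ex. 1.6 (c); [Harari2020] Thm. 17.13 (b); [Howard2004HeegnerKolyvagin] Thm. 2.1.11.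
-/

noncomputable section

open Function NumberField IsDedekindDomain
open scoped NumberField

universe u

set_option linter.dupNamespace false
set_option autoImplicit false

namespace Summit.BirchSwinnertonDyer.BirchSwinnertonDyer.Theorems.SignedEC.MuReal

open Literature.NumberTheory.GaloisRepresentations
open Literature.NumberTheory.GaloisRepresentations.DiscreteGaloisModule (mu localTatePairingZMod tateDual
  unramifiedSubgroup sha shaTwo)
open Literature.NumberTheory.GaloisCohomology
open Summit.BirchSwinnertonDyer.BirchSwinnertonDyer.Theorems.SchneiderFreeAdditiveX3.PoitouTateReduction
  (unramifiedOrthogonal_of_isPerfect_allLevels selmerComplement_canonical_of_middleExact_allLevels)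

/-! ## §1 Any family injective at the real places -/

section AnyFamily

variable {K : Type u} [Field K] [NumberField K] {M : Type u} [AddCommGroup M] [TopologicalSpace M]
  [DiscreteTopology M] [Finite M] {n : ℕ} [NeZero n]

/-- **`#Ш²(K, M) ≤ #Ш¹(K, M^D)` from a readout of `Ш²` modulo sums of local pairings — ANY number field** (the counting
half of Milne I Thm. 4.10 (a); real-place version of `PoitouTateShaAnnihilator.natCard_shaTwo_le_of_readout`).  `inv` with
`IsPerfect`, `InjectiveAtRealPlaces`, `UnramifiedOrthogonal`, `SelmerComplement`; `M` finite `n`-torsion, unramified off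
the finite `S₀ ⊇ {v ∣ ∞} ∪ {v ∣ n}`; `Ш¹(K, M^D)` finite.  READOUT `e : Ш²(K, M) → Hom(H¹(K, M^D), ℤ/n)`: (add) for all
`c, c'` the functional `e(c + c') − e(c) − e(c')` is, on the classes unramified off some finite `S₁`, a local sum
`∑_{v ∈ S} inv_v(t_v ∪ y_v)`; (inj) if `e(c)` is such a sum for a family `t` unramified off `S₁ ⊇ S₀` (archimedean
components arbitrary), then `c = 0`.  CONCLUSION: `Ш²(K, M)` is finite and `#Ш²(K, M) ≤ #Ш¹(K, M^D)`.
[cite: MilneADT2006, Ch. I, Thm. 4.10 (a) and proof, §0 Prop. 0.19, Thm. 2.13 (a)] [cite: Harari2020, Thm. 17.13 (b)] -/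
theorem natCard_shaTwo_le_of_readout_real
    {inv : LocalInvariants K n} (hperf : inv.IsPerfect) (hreal : inv.InjectiveAtRealPlaces)
    (hur : inv.UnramifiedOrthogonal) (hcomp : inv.SelmerComplement)
    (ρ : DiscreteGaloisModule K M) (hM : ∀ m : M, n • m = 0)
    (S₀ : Finset (Place K)) (hinf : ∀ w : InfinitePlace K, (Sum.inl w : Place K) ∈ S₀)
    (hS₀ : ∀ v : HeightOneSpectrum (𝓞 K), (Sum.inr v : Place K) ∉ S₀ →
      ((n : ℕ) : 𝓞 K) ∉ v.asIdeal ∧ GaloisRep.IsUnramifiedAt v ρ)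
    [Finite (sha (ρ.tateDual n))]
    (e : shaTwo ρ → (galoisCohomology (ρ.tateDual n) 1 →+ ZMod n))
    (hadd : ∀ c c' : shaTwo ρ, ∃ (S₁ : Finset (Place K)) (t : Π v : Place K, galoisCohomology (ρ.toLocal v) 1),
      ∀ (y : galoisCohomology (ρ.tateDual n) 1) (S : Finset (Place K)), S₁ ⊆ S →
        (∀ v : HeightOneSpectrum (𝓞 K), (Sum.inr v : Place K) ∉ S →
          galoisCohomology.localization (ρ.tateDual n) (Sum.inr v) 1 y ∈
            unramifiedSubgroup (GaloisRep.toLocal v (ρ.tateDual n)) 1) →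
        (e (c + c') - e c - e c') y = ∑ v ∈ S, localTatePairingZMod ρ n v (inv v) (t v)
          (galoisCohomology.localization (ρ.tateDual n) v 1 y))
    (hinj : ∀ c : shaTwo ρ, (∃ (S₁ : Finset (Place K)) (t : Π v : Place K, galoisCohomology (ρ.toLocal v) 1),
      S₀ ⊆ S₁ ∧
      (∀ v : HeightOneSpectrum (𝓞 K), (Sum.inr v : Place K) ∉ S₁ →
        t (Sum.inr v) ∈ unramifiedSubgroup (GaloisRep.toLocal v ρ) 1) ∧
      ∀ (y : galoisCohomology (ρ.tateDual n) 1) (S : Finset (Place K)), S₁ ⊆ S →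
        (∀ v : HeightOneSpectrum (𝓞 K), (Sum.inr v : Place K) ∉ S →
          galoisCohomology.localization (ρ.tateDual n) (Sum.inr v) 1 y ∈
            unramifiedSubgroup (GaloisRep.toLocal v (ρ.tateDual n)) 1) →
        e c y = ∑ v ∈ S, localTatePairingZMod ρ n v (inv v) (t v)
          (galoisCohomology.localization (ρ.tateDual n) v 1 y)) → c = 0) :
    Finite (shaTwo ρ) ∧ Nat.card (shaTwo ρ) ≤ Nat.card (sha (ρ.tateDual n)) := by
  classical
  have hsha_loc : ∀ y : sha (ρ.tateDual n), ∀ v : Place K,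
      galoisCohomology.localization (ρ.tateDual n) v 1 (y : galoisCohomology (ρ.tateDual n) 1) = 0 :=
    fun y v => (DiscreteGaloisModule.mem_sha_iff _ _).1 y.2 v
  have hlocal0 : ∀ (S : Finset (Place K)) (t : Π v : Place K, galoisCohomology (ρ.toLocal v) 1)
      (y : sha (ρ.tateDual n)),
      ∑ v ∈ S, localTatePairingZMod ρ n v (inv v) (t v)
        (galoisCohomology.localization (ρ.tateDual n) v 1 (y : galoisCohomology (ρ.tateDual n) 1)) = 0 :=
    fun S t y => Finset.sum_eq_zero fun v _ => by rw [hsha_loc y v, map_zero]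
  -- the restriction `R : Ш²(K, M) →+ Hom(Ш¹(K, M^D), ℤ/n)`
  have hR_add : ∀ c c' : shaTwo ρ, (e (c + c')).comp (sha (ρ.tateDual n)).subtype =
      (e c).comp (sha (ρ.tateDual n)).subtype + (e c').comp (sha (ρ.tateDual n)).subtype := by
    intro c c'
    obtain ⟨S₁, t, h⟩ := hadd c c'
    ext y
    have hy := h (y : galoisCohomology (ρ.tateDual n) 1) S₁ le_rfl
      (fun v _ => by rw [hsha_loc y (Sum.inr v)]; exact AddSubgroup.zero_mem _)
    rw [hlocal0] at hy
    simp only [AddMonoidHom.sub_apply] at hy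
    simp only [AddMonoidHom.comp_apply, AddSubgroup.coe_subtype, AddMonoidHom.add_apply]
    rw [sub_sub, sub_eq_zero] at hy
    rw [hy]
  let R : shaTwo ρ →+ (sha (ρ.tateDual n) →+ ZMod n) :=
    { toFun := fun c => (e c).comp (sha (ρ.tateDual n)).subtype
      map_zero' := by
        have h := hR_add 0 0
        rw [add_zero] at h
        exact left_eq_add.1 h
      map_add' := hR_add }
  have hR : ∀ c, R c = (e c).comp (sha (ρ.tateDual n)).subtype := fun _ => rfl
  -- `R` is injective: a readout vanishing on `Ш¹` is a local sum with archimedean components, hence `c = 0` by (inj)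
  have hRinj : Injective R := by
    intro c c' hcc'
    rw [← sub_eq_zero]
    apply hinj
    have h0 : R (c - c') = 0 := by rw [map_sub, hcc', sub_self]
    have hφ : ∀ y ∈ sha (ρ.tateDual n), e (c - c') y = 0 := fun y hy => by
      have := DFunLike.congr_fun h0 ⟨y, hy⟩
      rwa [hR] at this
    exact exists_family_sum_localTatePairing_eq_real hperf hreal hur hcomp ρ hM S₀ hinf hS₀ (e (c - c')) hφ
  -- count
  have hshaN : ∀ y : sha (ρ.tateDual n), n • y = 0 := fun y => Subtype.ext (by
    rw [AddSubgroup.coe_nsmul, AddSubgroup.coe_zero]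
    exact galoisCohomology.nsmul_eq_zero_of_forall _
      (fun f => DiscreteGaloisModule.TateDual.nsmul_eq_zero f) _)
  haveI : Finite (sha (ρ.tateDual n) →+ ZMod n) := finite_addMonoidHom_zmod _ n
  haveI hfin : Finite (shaTwo ρ) := Finite.of_injective R hRinj
  refine ⟨hfin, ?_⟩
  calc Nat.card (shaTwo ρ) ≤ Nat.card (sha (ρ.tateDual n) →+ ZMod n) := Nat.card_le_card_of_injective R hRinj
    _ = Nat.card (sha (ρ.tateDual n)) := Nat.card_addMonoidHom_zmod hshaN

end AnyFamily

/-! ## §2 THE invariant maps: the count from `hE(n)` and an additive, injective readout -/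

section Canonical

variable {K : Type} [Field K] [NumberField K]

/-- **`Ш¹(K, M^D)`, `Ш²(K, M)` finite and `#Ш²(K, M) ≤ #Ш¹(K, M^D)` for THE invariant maps, from `hE(n)` and an additive,
injective degree-2 readout — ANY number field** (`K = ℚ`, `n = 2^k`, `M = E[2^k]`: what crux K4 consumes of
`poitouTate_sha_tateDual ℚ` through `SignedEC.ShaTwo.finite_shaTwo_primary_and_natCard_le`).  Hypotheses: Milne I 4.10 (b)
for `LocalInvariants.canonical K n` at level `n` (`hE`, the shape of `selmerComplement_canonical_of_middleExact_allLevels`);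
`M` finite `n`-torsion unramified off the finite `S₀ ⊇ {v ∣ ∞} ∪ {v ∣ n}`; readout `e` additive and injective modulo
canonical local sums (archimedean components live).  No surjectivity of the readout and no finiteness of `Ш¹` is assumed.
[cite: MilneADT2006, Ch. I, Thm. 4.10 (a)(b) and proof, Lemma 4.8, Thm. 2.13 (a), Ex. 1.6 (c)] [cite: Harari2020, Thm. 17.13 (b)] -/
theorem natCard_shaTwo_le_canonical_of_middleExact_of_readout (n : ℕ) [NeZero n]
    (hE : ∀ ⦃M : Type⦄ [AddCommGroup M] [TopologicalSpace M] [DiscreteTopology M] [Finite M]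
      (ρ : DiscreteGaloisModule K M), (∀ m : M, n • m = 0) →
      ∀ S : Finset (Place K), (∀ w : InfinitePlace K, (Sum.inl w : Place K) ∈ S) →
        (∀ v : HeightOneSpectrum (𝓞 K), (Sum.inr v : Place K) ∉ S →
          ((n : ℕ) : 𝓞 K) ∉ v.asIdeal ∧ GaloisRep.IsUnramifiedAt v ρ) →
        ∀ t : Π v : Place K, galoisCohomology (ρ.toLocal v) 1,
          (∀ y : galoisCohomology (ρ.tateDual n) 1,
            (∀ v : HeightOneSpectrum (𝓞 K), (Sum.inr v : Place K) ∉ S →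
              galoisCohomology.localization (ρ.tateDual n) (Sum.inr v) 1 y ∈
                unramifiedSubgroup (GaloisRep.toLocal v (ρ.tateDual n)) 1) →
            ∑ v ∈ S, localTatePairingZMod ρ n v (LocalInvariants.canonical K n v) (t v)
              (galoisCohomology.localization (ρ.tateDual n) v 1 y) = 0) →
          ∃ x : galoisCohomology ρ 1,
            (∀ v : HeightOneSpectrum (𝓞 K), (Sum.inr v : Place K) ∉ S →
              galoisCohomology.localization ρ (Sum.inr v) 1 x ∈
                unramifiedSubgroup (GaloisRep.toLocal v ρ) 1) ∧
            ∀ v ∈ S, galoisCohomology.localization ρ v 1 x = t v)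
    {M : Type} [AddCommGroup M] [TopologicalSpace M] [DiscreteTopology M] [Finite M]
    (ρ : DiscreteGaloisModule K M) (hM : ∀ m : M, n • m = 0)
    (S₀ : Finset (Place K)) (hinf : ∀ w : InfinitePlace K, (Sum.inl w : Place K) ∈ S₀)
    (hS₀ : ∀ v : HeightOneSpectrum (𝓞 K), (Sum.inr v : Place K) ∉ S₀ →
      ((n : ℕ) : 𝓞 K) ∉ v.asIdeal ∧ GaloisRep.IsUnramifiedAt v ρ)
    (e : shaTwo ρ → (galoisCohomology (ρ.tateDual n) 1 →+ ZMod n))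
    (hadd : ∀ c c' : shaTwo ρ, ∃ (S₁ : Finset (Place K)) (t : Π v : Place K, galoisCohomology (ρ.toLocal v) 1),
      ∀ (y : galoisCohomology (ρ.tateDual n) 1) (S : Finset (Place K)), S₁ ⊆ S →
        (∀ v : HeightOneSpectrum (𝓞 K), (Sum.inr v : Place K) ∉ S →
          galoisCohomology.localization (ρ.tateDual n) (Sum.inr v) 1 y ∈
            unramifiedSubgroup (GaloisRep.toLocal v (ρ.tateDual n)) 1) →
        (e (c + c') - e c - e c') y = ∑ v ∈ S, localTatePairingZMod ρ n v (LocalInvariants.canonical K n v) (t v)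
          (galoisCohomology.localization (ρ.tateDual n) v 1 y))
    (hinj : ∀ c : shaTwo ρ, (∃ (S₁ : Finset (Place K)) (t : Π v : Place K, galoisCohomology (ρ.toLocal v) 1),
      S₀ ⊆ S₁ ∧
      (∀ v : HeightOneSpectrum (𝓞 K), (Sum.inr v : Place K) ∉ S₁ →
        t (Sum.inr v) ∈ unramifiedSubgroup (GaloisRep.toLocal v ρ) 1) ∧
      ∀ (y : galoisCohomology (ρ.tateDual n) 1) (S : Finset (Place K)), S₁ ⊆ S →
        (∀ v : HeightOneSpectrum (𝓞 K), (Sum.inr v : Place K) ∉ S →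
          galoisCohomology.localization (ρ.tateDual n) (Sum.inr v) 1 y ∈
            unramifiedSubgroup (GaloisRep.toLocal v (ρ.tateDual n)) 1) →
        e c y = ∑ v ∈ S, localTatePairingZMod ρ n v (LocalInvariants.canonical K n v) (t v)
          (galoisCohomology.localization (ρ.tateDual n) v 1 y)) → c = 0) :
    Finite (sha (ρ.tateDual n)) ∧ Finite (shaTwo ρ) ∧ Nat.card (shaTwo ρ) ≤ Nat.card (sha (ρ.tateDual n)) := by
  haveI : Finite (sha (ρ.tateDual n)) := finite_sha_tateDual_of_isUnramifiedAt ρ n S₀ hS₀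
  obtain ⟨hfin, hle⟩ :=
    natCard_shaTwo_le_of_readout_real LocalInvariants.canonical_isPerfect LocalInvariants.canonical_injectiveAtRealPlaces
      (unramifiedOrthogonal_of_isPerfect_allLevels _ LocalInvariants.canonical_isPerfect)
      (selmerComplement_canonical_of_middleExact_allLevels n hE) ρ hM S₀ hinf hS₀ e hadd hinj
  exact ⟨inferInstance, hfin, hle⟩

end Canonical

end Summit.BirchSwinnertonDyer.BirchSwinnertonDyer.Theorems.SignedEC.MuReal

end
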